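import Mathlib
import HarnessLib
import Summits.NavierStokesRegularity.NavierStokesRegularity.Theorems.WakeRatchetMinimalViscousBlowupFrontClockQuiet

/-!
# Route `WakeRatchet`, crux `MinimalViscousBlowup` (stmt-NavierStokesRegularity-22743) — LINE g11-1 «threshold ray» (ns-idea-1 g11/g12), stub S5
# `stub_typeOneClock`: THE CLOCK CLAUSE FROM THE **FIRED** FRONT CLOCK (FC′) — ERRATUM-FC repair of `clock_of_frontClock`

ERRATUM-FC (ns-idea-1 g12, 2026-08-29): the front-clock hypothesis (FC) of `clock_of_frontClock` / `action_of_frontClock` /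
`typeOneClock_of_frontClock` quantifies over shells QUIET on `[0,t]` and is unsatisfiable on a trajectory with the one-shell datum and `T > 0`
(every shell `m ≥ 1` is quiet at `t = 0`), so those theorems are true but vacuous.  The INTENDED front clock is the FIRED form

  (FC′) `∀ m t, 0 ≤ t < T → (∃ s ∈ [0,t], c₀ν² ≤ λ^m‖X_m(s)‖²) → T − t ≤ K/λ^{2m}`, `c₀ = 1/(32768λ^{16})` (the S4 level),

«once shell `m` HAS FIRED, at most `K/λ^{2m}` of life remains».  This file re-proves the CLOCK clause of S5 from (FC′):
* `exists_fired_of_not_quiet` — bookkeeping: a shell not quiet on `[0,t]` has fired at some `s ≤ t`;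
* `pow_mul_sqrt_level_le` — the geometric gain of the pre-arrival levels, `λ^{2j}√(c_j) ≤ √c₀` with `c_j = c₀(2λ^{19})^{−j}`;
* `clock_of_firedClock` — **S5's CLOCK clause from (FC′)** (with `0 ≤ K`): `Λⁿ(T−t)‖X_n(t)‖ ≤ (T+K)(√C + νλ²√c₀)` for all `n`, `0 ≤ t < T`.
  Proof: at time `t` let `m` be the LEAST shell quiet on `[0,t]` (`exists_nonfired_shell`).  If `m ≤ n`, shell `n` is a pre-arrival tail of the
  quiet shell `m` (`tails_of_nonfired`: `λⁿ‖X_n(t)‖² ≤ c_{n−m}ν²`), and either `m = 0` (use `T − t ≤ T`) or shell `m−1` has FIRED, so (FC′) gives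
  `T − t ≤ K/λ^{2(m−1)}`; if `m > n`, shell `n` itself has fired, (FC′) gives `T − t ≤ K/λ^{2n}` and the envelope bounds `X_n`.
MODEL lattice ODEs only; nothing here concerns the Navier–Stokes equations (no NS regularity statement is proved).
`--supports stmt-NavierStokesRegularity-22743 --as helper`.
[cite: Tao2016AveragedNS, §4 Lemma 4.1 (4.5), §5 (the blow-up clock of the cascade); BarbatoMorandinRomito2011, §3.1]
-/

noncomputable section

-- the summit and its single sub-problem share the name (CONVENTIONS §1)
set_option linter.dupNamespace false

open Set Filter Topology

namespace Summit.NavierStokesRegularity.NavierStokesRegularity.Theorems.MinimalViscousBlowup.ThresholdRay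

open Literature.Analysis.FluidPDE Literature.Analysis.FluidPDE.TaoCascade

/-- Bookkeeping: a shell that is NOT quiet on `[0,t]` (level `c`) has fired at some time `s ∈ [0,t]`. [folklore] -/
theorem exists_fired_of_not_quiet {ε₀ c : ℝ} {X : Fin 4 → ℤ → ℝ → ℝ} {m : ℕ} {t : ℝ}
    (h : ¬ ∀ s, 0 ≤ s → s ≤ t → (1 + ε₀) ^ m * ‖shellVec X m s‖ ^ 2 < c) :
    ∃ s, 0 ≤ s ∧ s ≤ t ∧ c ≤ (1 + ε₀) ^ m * ‖shellVec X m s‖ ^ 2 := by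
  by_contra hne
  apply h
  intro s h0 h1
  by_contra hlt
  exact hne ⟨s, h0, h1, not_lt.1 hlt⟩

/-- The geometric gain of the pre-arrival levels `c_j = c₀(2λ^{19})^{−j}`: `λ^{2j}√(c_j) ≤ √c₀` (`λ = 1+ε₀ ≥ 1`, `c₀ ≥ 0`). [folklore] -/
theorem pow_mul_sqrt_level_le {ε₀ c₀ : ℝ} (hε : 0 ≤ ε₀) (hc₀ : 0 ≤ c₀) (j : ℕ) :
    (1 + ε₀) ^ (2 * j) * Real.sqrt (c₀ / (2 * (1 + ε₀) ^ 19) ^ j) ≤ Real.sqrt c₀ := by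
  have hl1 : (1 : ℝ) ≤ 1 + ε₀ := by linarith
  have hcj0 : 0 ≤ c₀ / (2 * (1 + ε₀) ^ 19) ^ j := by positivity
  have hsq : ((1 + ε₀) ^ (2 * j) * Real.sqrt (c₀ / (2 * (1 + ε₀) ^ 19) ^ j)) ^ 2 ≤ (Real.sqrt c₀) ^ 2 := by
    rw [mul_pow, Real.sq_sqrt hcj0, Real.sq_sqrt hc₀, ← pow_mul, show 2 * j * 2 = 4 * j by ring,
      pow_mul, mul_div_assoc', div_le_iff₀ (by positivity), mul_comm c₀]
    refine mul_le_mul_of_nonneg_right (pow_le_pow_left₀ (by positivity) ?_ _) hc₀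
    linarith [one_le_pow₀ hl1 (n := 19), pow_le_pow_right₀ hl1 (show 4 ≤ 19 by norm_num)]
  exact (pow_le_pow_iff_left₀ (by positivity) (Real.sqrt_nonneg _) two_ne_zero).1 hsq

/-- **S5 CLOCK clause from the FIRED front clock (FC′)** (ERRATUM-FC repair of `clock_of_frontClock`).  `λ = 1+ε₀ > 1`, `ν > 0`, a cancelling table
with `|α_{··(0,0,1)}| ≤ 1`, a regular trajectory of the `ν`-viscous lattice on `[0,T)` from a one-shell datum with no shells below `0`, a critical envelope
`λⁿ‖X_n(t)‖² ≤ C`, a constant `K ≥ 0`, and the FIRED front clock at the S4 level `c₀ = 1/(32768λ^{16})`: a shell `m` that has fired at some `s ≤ t`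
forces `T − t ≤ K/λ^{2m}`.  Then `Λⁿ(T−t)‖X_n(t)‖ ≤ (T+K)(√C + νλ²√c₀)` for all `n` and `0 ≤ t < T` (`Λ = bigLam ε₀ = λ^{5/2}`).
[cite: Tao2016AveragedNS, §4 Lemma 4.1 (4.5), §5; BarbatoMorandinRomito2011, §3.1] -/
theorem clock_of_firedClock {ε₀ ν T C K : ℝ} (hε : 0 < ε₀) (hν : 0 < ν) (hT : 0 < T) (hK : 0 ≤ K)
    {α : Fin 4 → Fin 4 → Fin 4 → ℤ × ℤ × ℤ → ℝ} (hcan : IsCancellingCoeff α) (hα1 : ∀ i₁ i₂ i₃, |α i₁ i₂ i₃ (0, 0, 1)| ≤ 1)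
    {X₀ : Fin 4 → ℝ} {X : Fin 4 → ℤ → ℝ → ℝ}
    (hcd : ∀ i n, ContDiffOn ℝ 1 (X i n) (Ico 0 T))
    (hinit : ∀ i n, X i n 0 = if n = 0 then X₀ i else 0)
    (hlow : ∀ i n t, n < 0 → X i n t = 0)
    (hmot : ∀ i n t, 0 ≤ t → t < T → derivWithin (X i n) (Ici 0) t =
      quadTerm ε₀ α X i n t - ν * (1 + ε₀) ^ ((2 : ℝ) * n) * X i n t)
    (hreg : ∀ T' : ℝ, 0 < T' → T' < T → ∃ M : ℝ, ∀ t : ℝ, 0 ≤ t → t ≤ T' →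
      ∀ (i : Fin 4) (n : ℤ), (1 + (1 + ε₀) ^ ((10 : ℝ) * n)) * |X i n t| ≤ M)
    (henv : ∀ (n : ℤ) (t : ℝ), 0 ≤ t → t < T → (1 + ε₀) ^ n * ‖shellVec X n t‖ ^ 2 ≤ C)
    (hFC : ∀ (m : ℕ) (t : ℝ), 0 ≤ t → t < T →
      (∃ s, 0 ≤ s ∧ s ≤ t ∧ 1 / (32768 * (1 + ε₀) ^ 16) * ν ^ 2 ≤ (1 + ε₀) ^ m * ‖shellVec X m s‖ ^ 2) →
      T - t ≤ K / (1 + ε₀) ^ (2 * m)) :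
    ∀ (n : ℤ) (t : ℝ), 0 ≤ t → t < T →
      bigLam ε₀ ^ n * (T - t) * ‖shellVec X n t‖ ≤
        (T + K) * (Real.sqrt C + ν * (1 + ε₀) ^ 2 * Real.sqrt (1 / (32768 * (1 + ε₀) ^ 16))) := by
  intro n t ht0 htT
  have hl0 : (0 : ℝ) < 1 + ε₀ := by linarith
  have hl1 : (1 : ℝ) ≤ 1 + ε₀ := by linarith
  have hl2 : (1 : ℝ) ≤ (1 + ε₀) ^ 2 := one_le_pow₀ hl1
  set c₀ : ℝ := 1 / (32768 * (1 + ε₀) ^ 16) with hc₀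
  have hc₀0 : 0 < c₀ := by rw [hc₀]; positivity
  have hC0 : 0 ≤ C := le_trans (by positivity) (henv 0 0 le_rfl hT)
  have hTt : 0 ≤ T - t := by linarith
  have hTtT : T - t ≤ T := by linarith
  -- the right-hand side and its three visible pieces
  have hsC : 0 ≤ Real.sqrt C := Real.sqrt_nonneg C
  have hsc : 0 ≤ Real.sqrt c₀ := Real.sqrt_nonneg c₀
  have hνc : ν * Real.sqrt c₀ ≤ ν * (1 + ε₀) ^ 2 * Real.sqrt c₀ := by
    have : ν * Real.sqrt c₀ * 1 ≤ ν * Real.sqrt c₀ * (1 + ε₀) ^ 2 := mul_le_mul_of_nonneg_left hl2 (by positivity)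
    linarith
  have hexp : (T + K) * (Real.sqrt C + ν * (1 + ε₀) ^ 2 * Real.sqrt c₀) =
      T * Real.sqrt C + K * Real.sqrt C + T * (ν * (1 + ε₀) ^ 2 * Real.sqrt c₀) + K * (ν * (1 + ε₀) ^ 2 * Real.sqrt c₀) := by ring
  have hp1 : 0 ≤ T * Real.sqrt C := by positivity
  have hp2 : 0 ≤ K * Real.sqrt C := by positivity
  have hp3 : 0 ≤ T * (ν * (1 + ε₀) ^ 2 * Real.sqrt c₀) := by positivity
  have hp4 : 0 ≤ K * (ν * (1 + ε₀) ^ 2 * Real.sqrt c₀) := by positivity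
  have hRHS : 0 ≤ (T + K) * (Real.sqrt C + ν * (1 + ε₀) ^ 2 * Real.sqrt c₀) := by positivity
  -- shells below the datum vanish
  rcases lt_or_ge n 0 with hn | hn
  · have h0 : shellVec X n t = 0 := by
      ext j
      simp [shellVec_apply, hlow j n t hn]
    rw [h0, norm_zero, mul_zero]
    exact hRHS
  obtain ⟨n', rfl⟩ := Int.eq_ofNat_of_zero_le hn
  rw [zpow_natCast]
  classical
  -- Step 1: the LEAST shell `m` quiet on `[0,t]`
  have hex := exists_nonfired_shell hε hν hreg ht0 htT
  obtain ⟨m, hm, hmin⟩ : ∃ m : ℕ, (∀ s, 0 ≤ s → s ≤ t →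
      (1 + ε₀) ^ m * ‖shellVec X (m : ℤ) s‖ ^ 2 < 1 / (32768 * (1 + ε₀) ^ 16) * ν ^ 2) ∧
      ∀ m' < m, ¬ (∀ s, 0 ≤ s → s ≤ t →
        (1 + ε₀) ^ m' * ‖shellVec X (m' : ℤ) s‖ ^ 2 < 1 / (32768 * (1 + ε₀) ^ 16) * ν ^ 2) :=
    ⟨Nat.find hex, Nat.find_spec hex, fun m' hm' => Nat.find_min hex hm'⟩
  by_cases hmn : m ≤ n'
  · -- Step 2a: shell `n'` is a pre-arrival tail of the quiet shell `m`
    have htail := tails_of_nonfired hε hν hcan hα1 hcd hinit hmot hreg ht0 htT hm (n' - m)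
    have hidx : m + (n' - m) = n' := by omega
    rw [hidx] at htail
    set cj : ℝ := c₀ / (2 * (1 + ε₀) ^ 19) ^ (n' - m) with hcj
    have hcj0 : 0 ≤ cj := by rw [hcj]; positivity
    have hB : (1 + ε₀) ^ n' * ‖shellVec X (n' : ℤ) t‖ ^ 2 ≤ (ν * Real.sqrt cj) ^ 2 := by
      rw [mul_pow, Real.sq_sqrt hcj0]
      have htail' : (1 + ε₀) ^ n' * ‖shellVec X (n' : ℤ) t‖ ^ 2 ≤ cj * ν ^ 2 := by
        simpa only [hcj, hc₀] using htail
      linarith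
    have hb := bigLam_pow_mul_norm_le hε (by positivity) n' hB
    have hgain : (1 + ε₀) ^ (2 * (n' - m)) * Real.sqrt cj ≤ Real.sqrt c₀ := pow_mul_sqrt_level_le hε.le hc₀0.le (n' - m)
    have hsplit : (1 + ε₀) ^ (2 * n') = (1 + ε₀) ^ (2 * m) * (1 + ε₀) ^ (2 * (n' - m)) := by
      rw [← pow_add]; congr 1; omega
    rcases Nat.eq_zero_or_pos m with hm0 | hmpos
    · -- `m = 0`: no clock needed, `T − t ≤ T`
      subst hm0
      calc bigLam ε₀ ^ n' * (T - t) * ‖shellVec X (n' : ℤ) t‖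
          = (bigLam ε₀ ^ n' * ‖shellVec X (n' : ℤ) t‖) * (T - t) := by ring
        _ ≤ ((1 + ε₀) ^ (2 * n') * (ν * Real.sqrt cj)) * T := mul_le_mul hb hTtT hTt (by positivity)
        _ = T * ν * ((1 + ε₀) ^ (2 * (n' - 0)) * Real.sqrt cj) := by rw [hsplit]; ring
        _ ≤ T * ν * Real.sqrt c₀ := mul_le_mul_of_nonneg_left hgain (by positivity)
        _ ≤ (T + K) * (Real.sqrt C + ν * (1 + ε₀) ^ 2 * Real.sqrt c₀) := by
            rw [hexp]
            have : T * ν * Real.sqrt c₀ ≤ T * (ν * (1 + ε₀) ^ 2 * Real.sqrt c₀) := by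
              have := mul_le_mul_of_nonneg_left hνc hT.le
              linarith [mul_assoc T ν (Real.sqrt c₀)]
            linarith
    · -- `m ≥ 1`: shell `m − 1` is not quiet on `[0,t]`, hence FIRED; (FC′) bounds the remaining life
      have hfired := exists_fired_of_not_quiet (hmin (m - 1) (by omega))
      have hKt : T - t ≤ K / (1 + ε₀) ^ (2 * (m - 1)) := hFC (m - 1) t ht0 htT hfired
      have hP : (0 : ℝ) < (1 + ε₀) ^ (2 * (m - 1)) := pow_pos hl0 _
      have hsplit' : (1 + ε₀) ^ (2 * m) = (1 + ε₀) ^ (2 * (m - 1)) * (1 + ε₀) ^ 2 := by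
        rw [← pow_add]; congr 1; omega
      calc bigLam ε₀ ^ n' * (T - t) * ‖shellVec X (n' : ℤ) t‖
          = (bigLam ε₀ ^ n' * ‖shellVec X (n' : ℤ) t‖) * (T - t) := by ring
        _ ≤ ((1 + ε₀) ^ (2 * n') * (ν * Real.sqrt cj)) * (K / (1 + ε₀) ^ (2 * (m - 1))) :=
            mul_le_mul hb hKt hTt (by positivity)
        _ = K * ν * (1 + ε₀) ^ 2 * ((1 + ε₀) ^ (2 * (n' - m)) * Real.sqrt cj) := by
            rw [hsplit, hsplit']; field_simp
        _ ≤ K * ν * (1 + ε₀) ^ 2 * Real.sqrt c₀ := mul_le_mul_of_nonneg_left hgain (by positivity)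
        _ ≤ (T + K) * (Real.sqrt C + ν * (1 + ε₀) ^ 2 * Real.sqrt c₀) := by
            rw [hexp]; linarith [mul_assoc K ν ((1 + ε₀) ^ 2)]
  · -- Step 2b: shell `n'` itself is not quiet on `[0,t]`, hence FIRED: (FC′) at `n'` and the envelope
    have hfired := exists_fired_of_not_quiet (hmin n' (by omega))
    have hKt : T - t ≤ K / (1 + ε₀) ^ (2 * n') := hFC n' t ht0 htT hfired
    have hP : (0 : ℝ) < (1 + ε₀) ^ (2 * n') := pow_pos hl0 _
    have he := henv n' t ht0 htT
    rw [zpow_natCast, ← Real.sq_sqrt hC0] at he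
    have hb := bigLam_pow_mul_norm_le hε (Real.sqrt_nonneg C) n' he
    calc bigLam ε₀ ^ n' * (T - t) * ‖shellVec X (n' : ℤ) t‖
        = (bigLam ε₀ ^ n' * ‖shellVec X (n' : ℤ) t‖) * (T - t) := by ring
      _ ≤ ((1 + ε₀) ^ (2 * n') * Real.sqrt C) * (K / (1 + ε₀) ^ (2 * n')) := mul_le_mul hb hKt hTt (by positivity)
      _ = K * Real.sqrt C := by field_simp
      _ ≤ (T + K) * (Real.sqrt C + ν * (1 + ε₀) ^ 2 * Real.sqrt c₀) := by rw [hexp]; linarith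

/-- FILING NORM (director-ns KEY-NS #208 (4)): the hypothesis block of `clock_of_firedClock` (= that of `action_of_firedClock`) is JOINTLY
SATISFIABLE — toy inhabitant: the zero trajectory of the zero table from the zero datum (`ε₀ = ν = T = 1`, `C = K = 0`), on which (FC′) holds
because no shell ever fires.  (On this very instance the quiet-shell form (FC) fails: every shell is quiet on `[0,0]`, so (FC) would force
`1 ≤ 0`.)  A joint inhabitant of all ten binders of S5 itself (a blow-up trajectory in the table class under a critical envelope) is
Target-level — none is cheap. [folklore] -/
example : ∃ (ε₀ ν T C K : ℝ) (α : Fin 4 → Fin 4 → Fin 4 → ℤ × ℤ × ℤ → ℝ) (X₀ : Fin 4 → ℝ) (X : Fin 4 → ℤ → ℝ → ℝ),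
    0 < ε₀ ∧ 0 < ν ∧ 0 < T ∧ 0 ≤ K ∧ IsCancellingCoeff α ∧ (∀ i₁ i₂ i₃, |α i₁ i₂ i₃ (0, 0, 1)| ≤ 1) ∧
    (∀ i n, ContDiffOn ℝ 1 (X i n) (Ico 0 T)) ∧
    (∀ i n, X i n 0 = if n = 0 then X₀ i else 0) ∧
    (∀ i n t, n < 0 → X i n t = 0) ∧
    (∀ i n t, 0 ≤ t → t < T → derivWithin (X i n) (Ici 0) t =
      quadTerm ε₀ α X i n t - ν * (1 + ε₀) ^ ((2 : ℝ) * n) * X i n t) ∧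
    (∀ T' : ℝ, 0 < T' → T' < T → ∃ M : ℝ, ∀ t : ℝ, 0 ≤ t → t ≤ T' →
      ∀ (i : Fin 4) (n : ℤ), (1 + (1 + ε₀) ^ ((10 : ℝ) * n)) * |X i n t| ≤ M) ∧
    (∀ (n : ℤ) (t : ℝ), 0 ≤ t → t < T → (1 + ε₀) ^ n * ‖shellVec X n t‖ ^ 2 ≤ C) ∧
    (∀ (m : ℕ) (t : ℝ), 0 ≤ t → t < T →
      (∃ s, 0 ≤ s ∧ s ≤ t ∧ 1 / (32768 * (1 + ε₀) ^ 16) * ν ^ 2 ≤ (1 + ε₀) ^ m * ‖shellVec X m s‖ ^ 2) →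
      T - t ≤ K / (1 + ε₀) ^ (2 * m)) := by
  have hz : ∀ (k : ℤ) (t : ℝ), shellVec (fun (_ : Fin 4) (_ : ℤ) (_ : ℝ) => (0 : ℝ)) k t = 0 := fun k t => by
    ext j
    simp [shellVec_apply]
  refine ⟨1, 1, 1, 0, 0, fun _ _ _ _ => 0, fun _ => 0, fun _ _ _ => 0, one_pos, one_pos, one_pos, le_rfl,
    ?_, ?_, ?_, ?_, ?_, ?_, ?_, ?_, ?_⟩
  · intro i₁ i₂ i₃ μ₁ μ₂ μ₃ _
    simp
  · intro i₁ i₂ i₃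
    simp
  · intro i n
    exact contDiffOn_const
  · intro i n
    simp
  · intro i n t _
    rfl
  · intro i n t _ _
    simp [quadTerm]
  · intro T' _ _
    exact ⟨0, fun t _ _ i n => by simp⟩
  · intro n t _ _
    rw [hz, norm_zero]
    norm_num
  · rintro m t _ _ ⟨s, _, _, hs⟩
    rw [hz, norm_zero] at hs
    norm_num at hs

end Summit.NavierStokesRegularity.NavierStokesRegularity.Theorems.MinimalViscousBlowup.ThresholdRay

end
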